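import Summits.AnomalousDissipation.AnomalousDissipation.Theorems.SawtoothPulseCascadeK1LocalisedCascadeCanonicalRatioStepsOsc
import Summits.AnomalousDissipation.AnomalousDissipation.Theorems.SawtoothPulseCascadeK1LocalisedCascadeRatioBlocksCT
import Summits.AnomalousDissipation.AnomalousDissipation.Theorems.SawtoothPulseCascadeK1LocalisedCascadeBlockJunkCT

/-!
# K1loc — helper: THE RATIO-CLASS STEPS ON CANONICAL BLOCKS, CORNER-TRACE GRADE (generic lower cut-off, closed-form junk)

Helper file of the prover lane on the crux `K1LocalisedCascade` (stmt-AnomalousDissipation-19491), route `SawtoothPulseCascade`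
(S-D seat, arbiter A24-4: the phase-3 CT ledger, concrete layer; 1:1 port of ad-k1loc-p2's `…CanonicalRatioStepsOsc` over
`…RatioBlocksCT`).  The ratio-class steps of `…RatioBlocksCT` (O-V, A-V, C-H, B-H over the corner-trace window blocks) on the
CANONICAL geometry (`Λ_m = Λ₀2^m`, `Q₂^m = ⌊q_nΛ_m/q_d⌋`, generic `Q₁^m < Q₂^m` with the feed inclusion and `r_m ≤ r*`): the box
trapezoid of block `m` has plateau `L_m = Q₁^m` and ramp `R_m = Q₂^m − Q₁^m` (trace ratio `(2L_m+R_m)/R_m = r_m`), and every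
per-block scalar is DISCHARGED: gap floor `D_m ≥ D₀2^m`, `D₀ = ((uG−v)q_d − uq_n)Λ₀/(uq_d)` (`…CanonicalBlocksLog.canon_ratio_den_ge`),
fibre span `D_m + Q₂^m = S₀2^m`, `S₀ = (uG−v)Λ₀/u`, lobe `Q₂^m ≤ q₀2^m`, `q₀ = q_nΛ₀/q_d`, lobe/gap ratio
`ϑ = q₀/D₀ = uq_n/((uG−v)q_d − uq_n)`, rounding scale `Λ_{m+1}G = Λ₀G·2^{m+1}`; the junk is the closed form of
`…BlockJunkCT.blockJunk_ct_sum_le`: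
  `class ≤ (√J₁ + √J₂ + √feed)² + tail²`,
  `J₁ = (6N²r*(4/(3S₀²) + 2/(NS₀)) + 12N²ϑ²(4q₀/(NS₀²) + 4/(3S₀²) + 2/(NS₀) + M_b·2q₀/(N²S₀)))/π²`,
  `J₂ = (4/3)(πΛ₀Gε2^{M_b}/N)² + M_b·(8Mδ_j·r*/π)`,
zone parameter `M ≥ 1` with `Mδ_j < π/2` and rounding `ε ≥ e^{−M²/2}` (`N = N_j`).

* `ratioClass_vstep_canonicalCT_le` (V: O-V, A-V), `ratioClass_hstep_canonicalCT_le` (H: C-H, B-H).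

No definitions; no statement about the crux. [cite: Grafakos2014, Prop. 3.1.2 (5), Prop. 3.2.7 (3), §3.1.3] [problem: turb]
-/

-- `Summit.<Summit>.<Problem>`: single-conjunct summit, the duplicate namespace segment is deliberate.
set_option linter.dupNamespace false

noncomputable section

namespace Summit.AnomalousDissipation.AnomalousDissipation.Theorems.SawtoothPulseCascade.K1Window

open MeasureTheory Set Filter Topology UnitAddTorus Function Complex Metric
open scoped Real ENNReal
open Literature.Analysis Literature.Analysis.FunctionSpaces Literature.Analysis.FunctionSpaces.Torus Literature.Analysis.FluidPDE
open Literature.Analysis.FluidPDE.ShearStage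
open Literature.Analysis.FluidPDE.SawtoothCascade Literature.Analysis.FluidPDE.SawtoothCascade.CascadeParams
open Summit.AnomalousDissipation.AnomalousDissipation.Theorems.SawtoothPulseCascade.K1Start
open Summit.AnomalousDissipation.AnomalousDissipation.Theorems.SawtoothPulseCascade.K1Flat
open Summit.AnomalousDissipation.AnomalousDissipation.Theorems.SawtoothPulseCascade.K1Ledger.From

/-! ## §0 Glue: a squared junk amplitude inside the window shape; the trace ratio of a box trapezoid -/

/-- Window shape with a squared junk: `x ≤ (√S + √F)² + f`, `S ≤ w²` and `0 ≤ w` give `x ≤ (w + √F)² + f`. [folklore] -/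
theorem le_sq_sqrt_add_of_sq {x S F f w : ℝ} (h : x ≤ (Real.sqrt S + Real.sqrt F) ^ 2 + f) (hS : S ≤ w ^ 2) (hw : 0 ≤ w) :
    x ≤ (w + Real.sqrt F) ^ 2 + f := by
  have h1 : Real.sqrt S ≤ w := (Real.sqrt_le_sqrt hS).trans_eq (Real.sqrt_sq hw)
  exact h.trans (add_le_add (pow_le_pow_left₀ (add_nonneg (Real.sqrt_nonneg _) (Real.sqrt_nonneg _))
    (add_le_add h1 le_rfl) 2) le_rfl)

/-- The same with an exact pass-through term in front: `x ≤ T + ((√S + √F)² + f)`, `S ≤ w²`, `0 ≤ w` give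
`x ≤ T + ((w + √F)² + f)`. [folklore] -/
theorem le_add_sq_sqrt_add_of_sq {x T S F f w : ℝ} (h : x ≤ T + ((Real.sqrt S + Real.sqrt F) ^ 2 + f)) (hS : S ≤ w ^ 2)
    (hw : 0 ≤ w) : x ≤ T + ((w + Real.sqrt F) ^ 2 + f) := by
  have h1 : Real.sqrt S ≤ w := (Real.sqrt_le_sqrt hS).trans_eq (Real.sqrt_sq hw)
  exact h.trans (add_le_add le_rfl (add_le_add (pow_le_pow_left₀ (add_nonneg (Real.sqrt_nonneg _) (Real.sqrt_nonneg _))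
    (add_le_add h1 le_rfl) 2) le_rfl))

/-- **The two half traces of a box trapezoid add up to its trace ratio**: plateau `L`, ramp `R > 0`:
`(√((2L+R)R)/R)²/2 + (√((2L+R)R)/R)²/2 = (2L+R)/R`. [folklore] -/
theorem boxTrace_halves_eq (L : ℕ) {R : ℕ} (hR : 0 < R) :
    (Real.sqrt ((2 * L + R : ℕ) * R) / R * 1) ^ 2 / 2 + (Real.sqrt ((2 * L + R : ℕ) * R) / R * 1) ^ 2 / 2 =
      ((2 * L + R : ℕ) : ℝ) / R := by
  have hRr : (0 : ℝ) < R := by exact_mod_cast hR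
  have h0 : (0 : ℝ) ≤ ((2 * L + R : ℕ) : ℝ) * R := by positivity
  rw [add_halves, mul_one, div_pow, Real.sq_sqrt h0]
  field_simp

section Cascade

variable (P : CascadeParams)

/-! ## §1 The ratio class through the V half-step on canonical blocks (O-V, A-V) -/

/-- **(O-V) / (A-V) ON CANONICAL BLOCKS, CT GRADE.**  Class `Σ'[X ≤ |k₀| ∧ u|k₀| ≤ v|k₁|]‖𝓕a_{j+1}‖²` (`0 < u`, `0 < v < uG`),
feed slope `(u′, v′)`, margin `q_n/q_d` with `uq_n < q_d(uG − v)`, fibre floor `Λ₀ ≥ 1` with `vΛ₀ ≤ uX`, lower cut-offs `Q₁^m < Q₂^m`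
with the feed inclusion, `Y ≤ Q₁^m + 1` and `r_m ≤ r*`, `M_b` blocks, zone parameter `M ≥ 1` with `Mδ_j < π/2`, rounding `ε ≥ e^{−M²/2}`.
Then `class ≤ (√J₁ + √J₂ + √(Σ'[Y ≤ |k₀| ∧ u′|k₁| ≤ v′|k₀|]‖𝓕b_j‖²))² + ((1+γ)^{2(j+1)}/(Λ₀2^{M_b}))²` with `J₁`, `J₂` as in the
file header (`S₀ = (uG−v)Λ₀/u`, `q₀ = q_nΛ₀/q_d`, `ϑ = uq_n/((uG−v)q_d − uq_n)`). [cite: Grafakos2014, Prop. 3.1.2 (5), Prop. 3.2.7 (3), §3.1.3] -/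
theorem ratioClass_vstep_canonicalCT_le {G : ℕ} (hγ : P.γ = G) (hδ₀ : 0 < P.δ₀) (hd : 0 < P.d) (hN₀ : 1 ≤ P.N₀)
    (hρN : 1 ≤ P.ρN) (a b : ℕ → UnitAddTorus (Fin 2) → ℝ) (has : ∀ j, IsSmooth (a j)) (h0 : a 0 = datum)
    (hb : ∀ j, b j = a j ∘ shearMap 0 1 (amp ⟨P.U j, P.U_periodic j, P.contDiff_U (P.δ_pos hδ₀ hd j)⟩ P.γ))
    (hab : ∀ j, a (j + 1) = b j ∘ shearMap 1 0 (amp ⟨P.U j, P.U_periodic j, P.contDiff_U (P.δ_pos hδ₀ hd j)⟩ P.γ))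
    (j : ℕ) {u v X u' v' Y qn qd Λ0 : ℕ} (hu : 0 < u) (hv : 0 < v) (hvu : v < u * G) (hqd : 0 < qd)
    (hq : u * qn < qd * (u * G - v)) (hΛ0 : 1 ≤ Λ0) (hΛX : v * Λ0 ≤ u * X)
    (Q₁ : ℕ → ℕ) (hQ : ∀ m, Q₁ m < qn * (Λ0 * 2 ^ m) / qd)
    (hfeed : ∀ m, u' * (Λ0 * 2 ^ (m + 1)) ≤ v' * (Q₁ m + 1)) {rs : ℝ}
    (hr : ∀ m, (((Q₁ m : ℕ) : ℝ) + ((qn * (Λ0 * 2 ^ m) / qd : ℕ) : ℝ)) /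
      (((qn * (Λ0 * 2 ^ m) / qd : ℕ) : ℝ) - ((Q₁ m : ℕ) : ℝ)) ≤ rs)
    (hY : ∀ m, Y ≤ Q₁ m + 1) (Mb : ℕ) {M ε : ℝ} (hM : 1 ≤ M) (hMδ : M * P.δ j < π / 2)
    (hε : Real.exp (-(M ^ 2 / 2)) ≤ ε) :
    ∑' k : Fin 2 → ℤ, (if (X : ℤ) ≤ |k 0| ∧ (u : ℤ) * |k 0| ≤ (v : ℤ) * |k 1| then (1 : ℝ) else 0) *
        ‖mFourierCoeff (fun x => (a (j + 1) x : ℂ)) k‖ ^ 2 ≤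
      (Real.sqrt ((6 * (P.N j : ℝ) ^ 2 * rs *
              (4 / (3 * (((u : ℝ) * G - v) * Λ0 / u) ^ 2) + 2 / (P.N j * (((u : ℝ) * G - v) * Λ0 / u))) +
            12 * (P.N j : ℝ) ^ 2 * ((u : ℝ) * qn / (((u : ℝ) * G - v) * qd - u * qn)) ^ 2 *
              (4 * ((qn : ℝ) * Λ0 / qd) / (P.N j * (((u : ℝ) * G - v) * Λ0 / u) ^ 2) +
                4 / (3 * (((u : ℝ) * G - v) * Λ0 / u) ^ 2) + 2 / (P.N j * (((u : ℝ) * G - v) * Λ0 / u)) +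
                Mb * (2 * ((qn : ℝ) * Λ0 / qd) / ((P.N j : ℝ) ^ 2 * (((u : ℝ) * G - v) * Λ0 / u))))) / π ^ 2) +
          Real.sqrt (4 / 3 * (π * ((Λ0 : ℝ) * G) * ε * 2 ^ Mb / P.N j) ^ 2 + Mb * (8 * M * P.δ j / π * rs)) +
          Real.sqrt (∑' k : Fin 2 → ℤ, (if (Y : ℤ) ≤ |k 0| ∧ (u' : ℤ) * |k 1| ≤ (v' : ℤ) * |k 0| then (1 : ℝ) else 0) *
            ‖mFourierCoeff (fun x => (b j x : ℂ)) k‖ ^ 2)) ^ 2 +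
        ((1 + P.γ) ^ (2 * (j + 1)) / ((Λ0 * 2 ^ Mb : ℕ) : ℝ)) ^ 2 := by
  -- the canonical data
  have hN : (0 : ℝ) < P.N j := by exact_mod_cast P.N_pos hN₀ hρN j
  have hδ : 0 < P.δ j := P.δ_pos hδ₀ hd j
  have hε0 : 0 ≤ ε := (Real.exp_pos _).le.trans hε
  set Λb : ℕ → ℕ := fun m => Λ0 * 2 ^ m with hΛb
  set Q₂ : ℕ → ℕ := fun m => qn * (Λ0 * 2 ^ m) / qd with hQ₂
  set R : ℕ → ℕ := fun m => Q₂ m - Q₁ m with hRdef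
  set S₀ : ℝ := ((u : ℝ) * G - v) * Λ0 / u with hS₀
  set q₀ : ℝ := (qn : ℝ) * Λ0 / qd with hq₀
  set D₀ : ℝ := (((u : ℝ) * G - v) * qd - u * qn) * Λ0 / (u * qd) with hD₀
  have hΛge : ∀ m, 1 ≤ Λ0 * 2 ^ m := fun m => hΛ0.trans (canon_blocks_ge Λ0 m)
  have hur : (0 : ℝ) < u := by exact_mod_cast hu
  have hqdr : (0 : ℝ) < qd := by exact_mod_cast hqd
  have hΛ0r : (1 : ℝ) ≤ Λ0 := by exact_mod_cast hΛ0
  have hc2 : (0 : ℝ) < (u : ℝ) * G - v := by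
    have : (v : ℝ) < (u : ℝ) * G := by exact_mod_cast hvu
    linarith
  have hc3 : (0 : ℝ) < ((u : ℝ) * G - v) * qd - u * qn := by
    have h1 : ((u * qn : ℕ) : ℝ) < ((qd * (u * G - v) : ℕ) : ℝ) := by exact_mod_cast hq
    rw [Nat.cast_mul, Nat.cast_mul, Nat.cast_sub hvu.le, Nat.cast_mul] at h1
    linarith
  have hD₀pos : 0 < D₀ := by positivity
  have hS₀pos : 0 < S₀ := by positivity
  have hq₀0 : 0 ≤ q₀ := by positivity
  have eQR : ∀ m, Q₁ m + R m = Q₂ m := fun m => Nat.add_sub_cancel' (hQ m).le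
  have hRpos : ∀ m, 0 < R m := fun m => Nat.sub_pos_of_lt (hQ m)
  have hΛQ : ∀ m, u * (Q₁ m + R m) < Λb m * (u * G - v) := fun m => by
    rw [eQR]; exact canon_ratio_shift hq (hΛge m)
  -- the multi-block step
  have hstep := tsum_ratioClass_vstep_blocks_ct_le P hγ hδ₀ hd hN₀ hρN a b has h0 hb hab j hu hv hvu Λb
    (canon_blocks_monotone Λ0) (by simpa [hΛb] using hΛ0) Mb (by simpa [hΛb] using hΛX) Q₁ R hRpos hΛQ hM hMδ hε
    (u' := u') (v' := v') (Y := Y) hfeed hY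
  -- the block data of the junk lemma
  have hDge : ∀ m, D₀ * 2 ^ m ≤ (((u : ℝ) * G - v) * Λb m - u * ((Q₁ m + R m : ℕ) : ℝ)) / u := fun m => by
    rw [eQR]
    have h := canon_ratio_den_ge (v := v) (G := G) (qn := qn) (Λ0 := Λ0) hu hqd m
    have e : D₀ * 2 ^ m = (((u : ℝ) * G - v) * qd - u * qn) * Λ0 * 2 ^ m / (u * qd) := by rw [hD₀]; ring
    rw [e]; exact h
  have hS : ∀ m, S₀ * 2 ^ m ≤ (((u : ℝ) * G - v) * Λb m - u * ((Q₁ m + R m : ℕ) : ℝ)) / u + ((Q₁ m + R m : ℕ) : ℝ) :=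
    fun m => by
    have eΛ : ((Λb m : ℕ) : ℝ) = (Λ0 : ℝ) * 2 ^ m := by simp [hΛb]
    rw [eΛ, hS₀]
    apply le_of_eq
    field_simp
    ring
  have hQ0' : ∀ m, (0 : ℝ) ≤ ((Q₁ m + R m : ℕ) : ℝ) := fun m => by positivity
  have hQle : ∀ m, ((Q₁ m + R m : ℕ) : ℝ) ≤ q₀ * 2 ^ m := fun m => by
    rw [eQR, hq₀]
    have h := canon_Q₂_le qn qd (Λ0 * 2 ^ m)
    have e : (qn : ℝ) / qd * ((Λ0 * 2 ^ m : ℕ) : ℝ) = (qn : ℝ) * Λ0 / qd * 2 ^ m := by push_cast; ring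
    rw [← e]; exact h
  have hT : ∀ m, (Real.sqrt ((2 * Q₁ m + R m : ℕ) * R m) / R m * 1) ^ 2 / 2 +
      (Real.sqrt ((2 * Q₁ m + R m : ℕ) * R m) / R m * 1) ^ 2 / 2 ≤ rs := fun m => by
    rw [boxTrace_halves_eq (Q₁ m) (hRpos m)]
    have e1 : 2 * Q₁ m + R m = Q₁ m + Q₂ m := by rw [two_mul, add_assoc, eQR]
    have e2 : ((R m : ℕ) : ℝ) = ((Q₂ m : ℕ) : ℝ) - ((Q₁ m : ℕ) : ℝ) := by
      rw [← eQR m, Nat.cast_add]; ring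
    rw [e1, Nat.cast_add, e2]
    exact hr m
  have hT0 : ∀ m, 0 ≤ (Real.sqrt ((2 * Q₁ m + R m : ℕ) * R m) / R m * 1) ^ 2 / 2 +
      (Real.sqrt ((2 * Q₁ m + R m : ℕ) * R m) / R m * 1) ^ 2 / 2 := fun m => by positivity
  have hΛ'0 : ∀ m, (0 : ℝ) ≤ ((Λb (m + 1) * G : ℕ) : ℝ) := fun m => by positivity
  have hΛ' : ∀ m, ((Λb (m + 1) * G : ℕ) : ℝ) ≤ (Λ0 : ℝ) * G * 2 ^ (m + 1) := fun m => by
    apply le_of_eq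
    simp [hΛb]
    ring
  -- the junk in closed form
  have hjunk := blockJunk_ct_sum_le (D := fun m => (((u : ℝ) * G - v) * Λb m - u * ((Q₁ m + R m : ℕ) : ℝ)) / u)
    (Q := fun m => ((Q₁ m + R m : ℕ) : ℝ))
    (T := fun m => (Real.sqrt ((2 * Q₁ m + R m : ℕ) * R m) / R m * 1) ^ 2 / 2 +
      (Real.sqrt ((2 * Q₁ m + R m : ℕ) * R m) / R m * 1) ^ 2 / 2)
    (Λ' := fun m => ((Λb (m + 1) * G : ℕ) : ℝ)) (N := (P.N j : ℝ)) (D₀ := D₀) (S₀ := S₀) (q₀ := q₀) (rs := rs)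
    (ℓ₀ := (Λ0 : ℝ) * G) (ε := ε) (M := M) (δ := P.δ j) hN hD₀pos hS₀pos hq₀0 hε0 (by linarith) hδ.le
    hDge hS hQ0' hQle hT0 hT hΛ'0 hΛ' Mb
  beta_reduce at hjunk
  have eϑ : q₀ / D₀ = (u : ℝ) * qn / (((u : ℝ) * G - v) * qd - u * qn) := by
    rw [hq₀, hD₀]
    field_simp
  rw [eϑ] at hjunk
  exact le_sq_sqrt_add_of_sq hstep hjunk (add_nonneg (Real.sqrt_nonneg _) (Real.sqrt_nonneg _))

/-! ## §2 The ratio class through the H half-step on canonical blocks (C-H, B-H) -/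

/-- **(C-H) / (B-H) ON CANONICAL BLOCKS, CT GRADE.**  Class `Σ'[Λ₀ ≤ |k₀| ∧ u|k₁| ≤ v|k₀|]‖𝓕b_j‖²` (`0 < u`, `0 < v < uG`; the
class threshold is the fibre floor `Λ₀ ≥ 1`), feed = the class `Σ'[Y ≤ |k₀| ∧ u′|k₀| ≤ v′|k₁|]‖𝓕a_j‖²` of `a_j` (`Y ≤ Λ₀`),
margin `q_n/q_d` with `uq_n < q_d(uG − v)`, lower cut-offs `Q₁^m < Q₂^m` with the feed inclusion and `r_m ≤ r*`, `M_b` blocks,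
zone parameter `M ≥ 1` with `Mδ_j < π/2`, rounding `ε ≥ e^{−M²/2}`.  Then `class ≤ (√J₁ + √J₂ + √feed)² + ((1+γ)^{2j}/(Λ₀2^{M_b}))²`
with `J₁`, `J₂` as in the file header. [cite: Grafakos2014, Prop. 3.1.2 (5), Prop. 3.2.7 (3), §3.1.3] -/
theorem ratioClass_hstep_canonicalCT_le {G : ℕ} (hγ : P.γ = G) (hδ₀ : 0 < P.δ₀) (hd : 0 < P.d) (hN₀ : 1 ≤ P.N₀)
    (hρN : 1 ≤ P.ρN) (a b : ℕ → UnitAddTorus (Fin 2) → ℝ) (has : ∀ j, IsSmooth (a j)) (h0 : a 0 = datum)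
    (hb : ∀ j, b j = a j ∘ shearMap 0 1 (amp ⟨P.U j, P.U_periodic j, P.contDiff_U (P.δ_pos hδ₀ hd j)⟩ P.γ))
    (hab : ∀ j, a (j + 1) = b j ∘ shearMap 1 0 (amp ⟨P.U j, P.U_periodic j, P.contDiff_U (P.δ_pos hδ₀ hd j)⟩ P.γ))
    (j : ℕ) {u v u' v' Y qn qd Λ0 : ℕ} (hu : 0 < u) (hv : 0 < v) (hvu : v < u * G) (hqd : 0 < qd)
    (hq : u * qn < qd * (u * G - v)) (hΛ0 : 1 ≤ Λ0) (hY : Y ≤ Λ0)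
    (Q₁ : ℕ → ℕ) (hQ : ∀ m, Q₁ m < qn * (Λ0 * 2 ^ m) / qd)
    (hfeed : ∀ m, u' * (Λ0 * 2 ^ (m + 1)) ≤ v' * (Q₁ m + 1)) {rs : ℝ}
    (hr : ∀ m, (((Q₁ m : ℕ) : ℝ) + ((qn * (Λ0 * 2 ^ m) / qd : ℕ) : ℝ)) /
      (((qn * (Λ0 * 2 ^ m) / qd : ℕ) : ℝ) - ((Q₁ m : ℕ) : ℝ)) ≤ rs)
    (Mb : ℕ) {M ε : ℝ} (hM : 1 ≤ M) (hMδ : M * P.δ j < π / 2)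
    (hε : Real.exp (-(M ^ 2 / 2)) ≤ ε) :
    ∑' k : Fin 2 → ℤ, (if (Λ0 : ℤ) ≤ |k 0| ∧ (u : ℤ) * |k 1| ≤ (v : ℤ) * |k 0| then (1 : ℝ) else 0) *
        ‖mFourierCoeff (fun x => (b j x : ℂ)) k‖ ^ 2 ≤
      (Real.sqrt ((6 * (P.N j : ℝ) ^ 2 * rs *
              (4 / (3 * (((u : ℝ) * G - v) * Λ0 / u) ^ 2) + 2 / (P.N j * (((u : ℝ) * G - v) * Λ0 / u))) +
            12 * (P.N j : ℝ) ^ 2 * ((u : ℝ) * qn / (((u : ℝ) * G - v) * qd - u * qn)) ^ 2 *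
              (4 * ((qn : ℝ) * Λ0 / qd) / (P.N j * (((u : ℝ) * G - v) * Λ0 / u) ^ 2) +
                4 / (3 * (((u : ℝ) * G - v) * Λ0 / u) ^ 2) + 2 / (P.N j * (((u : ℝ) * G - v) * Λ0 / u)) +
                Mb * (2 * ((qn : ℝ) * Λ0 / qd) / ((P.N j : ℝ) ^ 2 * (((u : ℝ) * G - v) * Λ0 / u))))) / π ^ 2) +
          Real.sqrt (4 / 3 * (π * ((Λ0 : ℝ) * G) * ε * 2 ^ Mb / P.N j) ^ 2 + Mb * (8 * M * P.δ j / π * rs)) +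
          Real.sqrt (∑' k : Fin 2 → ℤ, (if (Y : ℤ) ≤ |k 0| ∧ (u' : ℤ) * |k 0| ≤ (v' : ℤ) * |k 1| then (1 : ℝ) else 0) *
            ‖mFourierCoeff (fun x => (a j x : ℂ)) k‖ ^ 2)) ^ 2 +
        ((1 + P.γ) ^ (2 * j) / ((Λ0 * 2 ^ Mb : ℕ) : ℝ)) ^ 2 := by
  -- the canonical data
  have hN : (0 : ℝ) < P.N j := by exact_mod_cast P.N_pos hN₀ hρN j
  have hδ : 0 < P.δ j := P.δ_pos hδ₀ hd j
  have hε0 : 0 ≤ ε := (Real.exp_pos _).le.trans hε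
  set Λb : ℕ → ℕ := fun m => Λ0 * 2 ^ m with hΛb
  set Q₂ : ℕ → ℕ := fun m => qn * (Λ0 * 2 ^ m) / qd with hQ₂
  set R : ℕ → ℕ := fun m => Q₂ m - Q₁ m with hRdef
  set S₀ : ℝ := ((u : ℝ) * G - v) * Λ0 / u with hS₀
  set q₀ : ℝ := (qn : ℝ) * Λ0 / qd with hq₀
  set D₀ : ℝ := (((u : ℝ) * G - v) * qd - u * qn) * Λ0 / (u * qd) with hD₀
  have hΛge : ∀ m, 1 ≤ Λ0 * 2 ^ m := fun m => hΛ0.trans (canon_blocks_ge Λ0 m)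
  have hur : (0 : ℝ) < u := by exact_mod_cast hu
  have hqdr : (0 : ℝ) < qd := by exact_mod_cast hqd
  have hΛ0r : (1 : ℝ) ≤ Λ0 := by exact_mod_cast hΛ0
  have hc2 : (0 : ℝ) < (u : ℝ) * G - v := by
    have : (v : ℝ) < (u : ℝ) * G := by exact_mod_cast hvu
    linarith
  have hc3 : (0 : ℝ) < ((u : ℝ) * G - v) * qd - u * qn := by
    have h1 : ((u * qn : ℕ) : ℝ) < ((qd * (u * G - v) : ℕ) : ℝ) := by exact_mod_cast hq
    rw [Nat.cast_mul, Nat.cast_mul, Nat.cast_sub hvu.le, Nat.cast_mul] at h1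
    linarith
  have hD₀pos : 0 < D₀ := by positivity
  have hS₀pos : 0 < S₀ := by positivity
  have hq₀0 : 0 ≤ q₀ := by positivity
  have eQR : ∀ m, Q₁ m + R m = Q₂ m := fun m => Nat.add_sub_cancel' (hQ m).le
  have hRpos : ∀ m, 0 < R m := fun m => Nat.sub_pos_of_lt (hQ m)
  have hΛQ : ∀ m, u * (Q₁ m + R m) < Λb m * (u * G - v) := fun m => by
    rw [eQR]; exact canon_ratio_shift hq (hΛge m)
  -- the multi-block step
  have hstep := tsum_ratioClass_hstep_blocks_ct_le P hγ hδ₀ hd hN₀ hρN a b has h0 hb hab j hu hv hvu Λb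
    (canon_blocks_monotone Λ0) (by simpa [hΛb] using hΛ0) Mb Q₁ R hRpos hΛQ hM hMδ hε
    (u' := u') (v' := v') (Y := Y) hfeed (by simpa [hΛb] using hY)
  -- the block data of the junk lemma
  have hDge : ∀ m, D₀ * 2 ^ m ≤ (((u : ℝ) * G - v) * Λb m - u * ((Q₁ m + R m : ℕ) : ℝ)) / u := fun m => by
    rw [eQR]
    have h := canon_ratio_den_ge (v := v) (G := G) (qn := qn) (Λ0 := Λ0) hu hqd m
    have e : D₀ * 2 ^ m = (((u : ℝ) * G - v) * qd - u * qn) * Λ0 * 2 ^ m / (u * qd) := by rw [hD₀]; ring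
    rw [e]; exact h
  have hS : ∀ m, S₀ * 2 ^ m ≤ (((u : ℝ) * G - v) * Λb m - u * ((Q₁ m + R m : ℕ) : ℝ)) / u + ((Q₁ m + R m : ℕ) : ℝ) :=
    fun m => by
    have eΛ : ((Λb m : ℕ) : ℝ) = (Λ0 : ℝ) * 2 ^ m := by simp [hΛb]
    rw [eΛ, hS₀]
    apply le_of_eq
    field_simp
    ring
  have hQ0' : ∀ m, (0 : ℝ) ≤ ((Q₁ m + R m : ℕ) : ℝ) := fun m => by positivity
  have hQle : ∀ m, ((Q₁ m + R m : ℕ) : ℝ) ≤ q₀ * 2 ^ m := fun m => by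
    rw [eQR, hq₀]
    have h := canon_Q₂_le qn qd (Λ0 * 2 ^ m)
    have e : (qn : ℝ) / qd * ((Λ0 * 2 ^ m : ℕ) : ℝ) = (qn : ℝ) * Λ0 / qd * 2 ^ m := by push_cast; ring
    rw [← e]; exact h
  have hT : ∀ m, (Real.sqrt ((2 * Q₁ m + R m : ℕ) * R m) / R m * 1) ^ 2 / 2 +
      (Real.sqrt ((2 * Q₁ m + R m : ℕ) * R m) / R m * 1) ^ 2 / 2 ≤ rs := fun m => by
    rw [boxTrace_halves_eq (Q₁ m) (hRpos m)]
    have e1 : 2 * Q₁ m + R m = Q₁ m + Q₂ m := by rw [two_mul, add_assoc, eQR]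
    have e2 : ((R m : ℕ) : ℝ) = ((Q₂ m : ℕ) : ℝ) - ((Q₁ m : ℕ) : ℝ) := by
      rw [← eQR m, Nat.cast_add]; ring
    rw [e1, Nat.cast_add, e2]
    exact hr m
  have hT0 : ∀ m, 0 ≤ (Real.sqrt ((2 * Q₁ m + R m : ℕ) * R m) / R m * 1) ^ 2 / 2 +
      (Real.sqrt ((2 * Q₁ m + R m : ℕ) * R m) / R m * 1) ^ 2 / 2 := fun m => by positivity
  have hΛ'0 : ∀ m, (0 : ℝ) ≤ ((Λb (m + 1) * G : ℕ) : ℝ) := fun m => by positivity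
  have hΛ' : ∀ m, ((Λb (m + 1) * G : ℕ) : ℝ) ≤ (Λ0 : ℝ) * G * 2 ^ (m + 1) := fun m => by
    apply le_of_eq
    simp [hΛb]
    ring
  -- the junk in closed form
  have hjunk := blockJunk_ct_sum_le (D := fun m => (((u : ℝ) * G - v) * Λb m - u * ((Q₁ m + R m : ℕ) : ℝ)) / u)
    (Q := fun m => ((Q₁ m + R m : ℕ) : ℝ))
    (T := fun m => (Real.sqrt ((2 * Q₁ m + R m : ℕ) * R m) / R m * 1) ^ 2 / 2 +
      (Real.sqrt ((2 * Q₁ m + R m : ℕ) * R m) / R m * 1) ^ 2 / 2)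
    (Λ' := fun m => ((Λb (m + 1) * G : ℕ) : ℝ)) (N := (P.N j : ℝ)) (D₀ := D₀) (S₀ := S₀) (q₀ := q₀) (rs := rs)
    (ℓ₀ := (Λ0 : ℝ) * G) (ε := ε) (M := M) (δ := P.δ j) hN hD₀pos hS₀pos hq₀0 hε0 (by linarith) hδ.le
    hDge hS hQ0' hQle hT0 hT hΛ'0 hΛ' Mb
  beta_reduce at hjunk
  have eϑ : q₀ / D₀ = (u : ℝ) * qn / (((u : ℝ) * G - v) * qd - u * qn) := by
    rw [hq₀, hD₀]
    field_simp
  rw [eϑ] at hjunk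
  have e0 : Λb 0 = Λ0 := by simp [hΛb]
  rw [e0] at hstep
  exact le_sq_sqrt_add_of_sq hstep hjunk (add_nonneg (Real.sqrt_nonneg _) (Real.sqrt_nonneg _))

end Cascade

end Summit.AnomalousDissipation.AnomalousDissipation.Theorems.SawtoothPulseCascade.K1Window
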